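import Summits.KontsevichZagierPeriods.KontsevichZagierPeriods.Theses.IsogenyCertificates
import Summits.KontsevichZagierPeriods.KontsevichZagierPeriods.Theorems.XMapPeriodTransfer.Negative.LemniscateReps
import Summits.KontsevichZagierPeriods.KontsevichZagierPeriods.Theorems.HermiteRigidityGenusTwoCycleTransferPushforwardDimOne
import Summits.KontsevichZagierPeriods.KontsevichZagierPeriods.Theorems.RealEllipticSectorKernel.Negative.GeneratorNotRelation
import Literature.NumberTheory.Transcendental.SemialgebraicLineDeriv

/-!
# `LemniscateTwoIsogeny` (stmt-KontsevichZagierPeriods-5382, route IsogenyCertificates)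

The calibration item of the route: the lemniscatic 2-isogeny `y² = x³ − x → Y² = X³ + 4X`,
`X = x − 1/x` (Silverman, AEC III.4.5 with `(a, b) = (0, −1)`), read on the real locus, is a
certificate of the Kontsevich–Zagier calculus joining
`[{x³ − x > 0}, 1/√(x³ − x)]` to `[{X³ + 4X > 0}, 2/√(X³ + 4X)]` in FOUR moves:

1. domain additivity (rule 1a): `{x³ − x > 0} = (−1, 0) ∪ (1, ∞)` (the egg and the unbounded
   branch), so `[r] = [r|egg] + [r|unbounded]`;
2. 3. change of variables (rule 2) along `Φ(x) = x − 1/x` on each sheet: `Φ' = 1 + 1/x² > 0`, `Φ`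
   maps each sheet increasingly onto `(0, ∞) = {X³ + 4X > 0}`, and
   `Φ³ + 4Φ = (x³ − x)·(1 + 1/x²)²`, whence the rule-2 identity
   `1/√(x³ − x) = (1/√(Φ³ + 4Φ))·|Φ'|`; both sheets land on the SAME representation
   `s = [{X³ + 4X > 0}, 1/√(X³ + 4X)]`;
4. integrand additivity (rule 1b): `2/√(X³ + 4X) = 1/√(X³ + 4X) + 1/√(X³ + 4X)`, so `[r'] = [s] + [s]`.

Hence `[r] − [r'] = ([r] − [r₁] − [r₂]) + ([r₁] − [s]) + ([r₂] − [s]) − ([r'] − [s] − [s]) ∈ KZ.relations`.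
(Both values equal `Γ(1/4)²/√(2π) = 2ϖ`; no value computation is needed here.)

`LemniscateTwoIsogeny_proof` concludes the route declaration
`Summit.KontsevichZagierPeriods.KontsevichZagierPeriods.Theses.IsogenyCertificates.LemniscateTwoIsogeny`
by name. No definitions are introduced; the x-map is written out as the lambda
`fun p _ => p 0 − (p 0)⁻¹` throughout. Reused from the tree: `cube_sub_self_pos_iff`,
`cube_add_four_mul_pos_iff` (XMapPeriodTransfer/Negative/LemniscateReps), `det_smul_id_fin_one`,
`hasFDerivAt_fin_one` (HermiteRigidityGenusTwoCycleTransferPushforwardDimOne), `isSemialgebraic_Ioi_one`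
(RealEllipticSectorKernel/Negative/GeneratorNotRelation).

References: J. H. Silverman, *The Arithmetic of Elliptic Curves* (2009), Example III.4.5;
M. Kontsevich, D. Zagier, *Periods* (2001), §1.2 rules (1), (2); D. F. Lawden, *Elliptic Functions
and Applications* (1989), §3 (Landen/Gauss transformation of order 2).
-/

noncomputable section

open Set MeasureTheory
open Literature.NumberTheory.Transcendental Literature.ModelTheory.ExponentialFields
open Summit.KontsevichZagierPeriods.IsogenyCertificates.XMapPeriodTransferValue
  (cube_sub_self_pos_iff cube_add_four_mul_pos_iff)
open Summit.KontsevichZagierPeriods.HermiteRigidity.GenusTwoCycleTransfer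
  (det_smul_id_fin_one hasFDerivAt_fin_one)
open Summit.KontsevichZagierPeriods.RealEllipticSectorKernel.GeneratorNotRelation
  (isSemialgebraic_Ioi_one)

namespace Summit.KontsevichZagierPeriods.IsogenyCertificates.LemniscateTwoIsogeny

/-! ### Real-variable facts about the x-map `x ↦ x − 1/x` of the 2-isogeny -/

/-- `x − 1/x = (x² − 1)/x` for `x ≠ 0`. [folklore] -/
theorem sub_inv_eq_div {x : ℝ} (hx : x ≠ 0) : x - x⁻¹ = (x ^ 2 - 1) / x := by
  field_simp

/-- On the egg `(−1, 0)` the x-map is positive. [folklore] -/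
theorem sub_inv_pos_of_egg {x : ℝ} (h1 : -1 < x) (h2 : x < 0) : 0 < x - x⁻¹ := by
  rw [sub_inv_eq_div h2.ne]
  exact div_pos_of_neg_of_neg (by nlinarith) h2

/-- On the unbounded branch `(1, ∞)` the x-map is positive. [folklore] -/
theorem sub_inv_pos_of_one_lt {x : ℝ} (h : 1 < x) : 0 < x - x⁻¹ := by
  rw [sub_inv_eq_div (by linarith : x ≠ 0)]
  exact div_pos (by nlinarith) (by linarith)

/-- The x-map is injective on each half-line: `x − 1/x = y − 1/y` with `xy > 0` forces `x = y`
(`(x − y)(xy + 1) = 0`). [folklore] -/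
theorem sub_inv_injective {x y : ℝ} (hxy : 0 < x * y) (h : x - x⁻¹ = y - y⁻¹) : x = y := by
  have hx : x ≠ 0 := by rintro rfl; simp at hxy
  have hy : y ≠ 0 := by rintro rfl; simp at hxy
  have hx1 : x * x⁻¹ = 1 := mul_inv_cancel₀ hx
  have hy1 : y * y⁻¹ = 1 := mul_inv_cancel₀ hy
  have key : (x - y) * (x * y + 1) = 0 := by
    have e : (x - x⁻¹) * (x * y) = (y - y⁻¹) * (x * y) := by rw [h]
    linear_combination e + y * hx1 - x * hy1
  rcases mul_eq_zero.mp key with h0 | h0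
  · exact sub_eq_zero.mp h0
  · exfalso; linarith

/-- Every `X > 0` is hit by the egg: `x = (X − √(X² + 4))/2 ∈ (−1, 0)` has `x − 1/x = X`. [folklore] -/
theorem exists_egg_preimage {X : ℝ} (hX : 0 < X) : ∃ x : ℝ, -1 < x ∧ x < 0 ∧ x - x⁻¹ = X := by
  set D : ℝ := Real.sqrt (X ^ 2 + 4) with hD
  have hD0 : 0 ≤ D := Real.sqrt_nonneg _
  have hD2 : D ^ 2 = X ^ 2 + 4 := Real.sq_sqrt (by positivity)
  have hDX : X < D := by nlinarith [hD2, hD0, hX]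
  have hD' : D < X + 2 := by nlinarith [hD2, hD0, hX]
  refine ⟨(X - D) / 2, by linarith, by linarith, ?_⟩
  have hx0 : (X - D) / 2 ≠ 0 := by intro h; linarith
  have hq : ((X - D) / 2) ^ 2 - X * ((X - D) / 2) - 1 = 0 := by linear_combination (1 / 4 : ℝ) * hD2
  rw [sub_inv_eq_div hx0, div_eq_iff hx0]
  linear_combination hq

/-- Every `X > 0` is hit by the unbounded branch: `x = (X + √(X² + 4))/2 > 1` has `x − 1/x = X`.
[folklore] -/
theorem exists_unbounded_preimage {X : ℝ} (hX : 0 < X) : ∃ x : ℝ, 1 < x ∧ x - x⁻¹ = X := by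
  set D : ℝ := Real.sqrt (X ^ 2 + 4) with hD
  have hD0 : 0 ≤ D := Real.sqrt_nonneg _
  have hD2 : D ^ 2 = X ^ 2 + 4 := Real.sq_sqrt (by positivity)
  have hx1 : 1 < (X + D) / 2 := by
    by_contra h
    have h1 : 0 ≤ 2 - X - D := by linarith [not_lt.mp h]
    have h2 : 0 ≤ 2 - X + D := by linarith
    nlinarith [mul_nonneg h1 h2, hD2, hX]
  refine ⟨(X + D) / 2, hx1, ?_⟩
  have hx0 : (X + D) / 2 ≠ 0 := by intro h; linarith
  have hq : ((X + D) / 2) ^ 2 - X * ((X + D) / 2) - 1 = 0 := by linear_combination (1 / 4 : ℝ) * hD2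
  rw [sub_inv_eq_div hx0, div_eq_iff hx0]
  linear_combination hq

/-- **The 2-isogeny identity on the real locus**: with `X = x − 1/x`,
`X³ + 4X = (x³ − x)·(1 + 1/x²)²` (i.e. `P'(R) = P·R'²/c²` with `c = 1`).
[cite: SilvermanAEC2009, Example III.4.5] -/
theorem xMap_cube_add_four_mul {x : ℝ} (hx : x ≠ 0) :
    (x - x⁻¹) ^ 3 + 4 * (x - x⁻¹) = (x ^ 3 - x) * (1 + (x ^ 2)⁻¹) ^ 2 := by
  field_simp
  ring

/-- **The rule-2 integrand identity** `1/√(x³ − x) = (1/√(X³ + 4X))·|1 + 1/x²|` at `X = x − 1/x`, on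
`{x³ − x > 0}`. [cite: KontsevichZagier2001, §1.2 rule (2)] -/
theorem jacobian_identity {x : ℝ} (hx : 0 < x ^ 3 - x) :
    1 / Real.sqrt (x ^ 3 - x) =
      1 / Real.sqrt ((x - x⁻¹) ^ 3 + 4 * (x - x⁻¹)) * |1 + (x ^ 2)⁻¹| := by
  have hx0 : x ≠ 0 := by rintro rfl; simp at hx
  rw [xMap_cube_add_four_mul hx0, Real.sqrt_mul hx.le, Real.sqrt_sq_eq_abs]
  have hk : 0 < |1 + (x ^ 2)⁻¹| := abs_pos.mpr (by positivity)
  have hs : 0 < Real.sqrt (x ^ 3 - x) := Real.sqrt_pos.mpr hx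
  field_simp

/-- The x-map `x ↦ x − 1/x` has derivative `1 + 1/x²` at `x ≠ 0`. [folklore] -/
theorem hasDerivAt_sub_inv {x : ℝ} (hx : x ≠ 0) :
    HasDerivAt (fun y : ℝ => y - y⁻¹) (1 + (x ^ 2)⁻¹) x := by
  exact ((hasDerivAt_id' x).sub (hasDerivAt_inv hx)).congr_deriv (by ring)

/-! ### The two sheets and the x-map on `ℝ¹ = Fin 1 → ℝ` -/

/-- The egg `{p | −1 < p 0 < 0} ⊆ ℝ¹` is `ℚ`-semialgebraic. [cite: BochnakCosteRoy1998, §2.1] -/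
theorem isSemialgebraic_egg :
    IsSemialgebraic ℚ {p : Fin 1 → ℝ | -1 < p 0 ∧ p 0 < 0} := by
  have h1 := isSemialgebraic_setOf_eval_pos (k := ℚ) (R := ℝ)
    (MvPolynomial.X 0 + 1 : MvPolynomial (Fin 1) ℚ)
  have h2 := isSemialgebraic_setOf_eval_pos (k := ℚ) (R := ℝ)
    (-MvPolynomial.X 0 : MvPolynomial (Fin 1) ℚ)
  convert h1.inter h2 using 1
  ext p
  simp only [mem_setOf_eq, mem_inter_iff, map_add, map_one, map_neg, MvPolynomial.aeval_X]
  constructor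
  · rintro ⟨ha, hb⟩; exact ⟨by linarith, by linarith⟩
  · rintro ⟨ha, hb⟩; exact ⟨by linarith, by linarith⟩

/-- The x-map `p ↦ (p 0 − 1/p 0)` is a `ℚ`-semialgebraic map on any `ℚ`-semialgebraic set avoiding
`{p 0 = 0}` (it is the rational function `(x² − 1)/x` there). [cite: BochnakCosteRoy1998, §2.2] -/
theorem isSemialgebraicMapOn_xMap {σ : Set (Fin 1 → ℝ)} (hσ : IsSemialgebraic ℚ σ)
    (h0 : ∀ p ∈ σ, p 0 ≠ 0) :
    IsSemialgebraicMapOn ℚ σ (fun (p : Fin 1 → ℝ) (_ : Fin 1) => p 0 - (p 0)⁻¹) := by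
  refine IsSemialgebraicMapOn.of_forall hσ fun _ => ?_
  have h := isSemialgebraicFunOn_aeval_div_aeval hσ
    (MvPolynomial.X 0 ^ 2 - 1 : MvPolynomial (Fin 1) ℚ) (MvPolynomial.X 0)
    (fun p hp => by simpa using h0 p hp)
  refine h.congr fun p hp => ?_
  simp only [map_sub, map_pow, map_one, MvPolynomial.aeval_X]
  exact (sub_inv_eq_div (h0 p hp)).symm

/-- A point of `ℝ¹` is the constant function with its value at `0`. [folklore] -/
theorem const_apply_zero_eq (X : Fin 1 → ℝ) : (fun _ : Fin 1 => X 0) = X := by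
  funext i
  rw [Fin.fin_one_eq_zero i]

/-- **The egg is mapped onto `{X³ + 4X > 0} = (0, ∞)`** by the x-map. [cite: SilvermanAEC2009, Example III.4.5] -/
theorem image_xMap_egg :
    (fun (p : Fin 1 → ℝ) (_ : Fin 1) => p 0 - (p 0)⁻¹) '' {p : Fin 1 → ℝ | -1 < p 0 ∧ p 0 < 0} =
      {X : Fin 1 → ℝ | 0 < X 0 ^ 3 + 4 * X 0} := by
  ext X
  simp only [mem_image, mem_setOf_eq]
  constructor
  · rintro ⟨p, ⟨hp1, hp2⟩, rfl⟩
    exact (cube_add_four_mul_pos_iff _).mpr (sub_inv_pos_of_egg hp1 hp2)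
  · intro hX
    obtain ⟨x, hx1, hx2, hx⟩ := exists_egg_preimage ((cube_add_four_mul_pos_iff _).mp hX)
    refine ⟨fun _ => x, ⟨hx1, hx2⟩, ?_⟩
    rw [← const_apply_zero_eq X]
    funext i
    exact hx

/-- **The unbounded branch is mapped onto `{X³ + 4X > 0} = (0, ∞)`** by the x-map.
[cite: SilvermanAEC2009, Example III.4.5] -/
theorem image_xMap_unbounded :
    (fun (p : Fin 1 → ℝ) (_ : Fin 1) => p 0 - (p 0)⁻¹) '' {p : Fin 1 → ℝ | 1 < p 0} =
      {X : Fin 1 → ℝ | 0 < X 0 ^ 3 + 4 * X 0} := by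
  ext X
  simp only [mem_image, mem_setOf_eq]
  constructor
  · rintro ⟨p, hp, rfl⟩
    exact (cube_add_four_mul_pos_iff _).mpr (sub_inv_pos_of_one_lt hp)
  · intro hX
    obtain ⟨x, hx1, hx⟩ := exists_unbounded_preimage ((cube_add_four_mul_pos_iff _).mp hX)
    refine ⟨fun _ => x, hx1, ?_⟩
    rw [← const_apply_zero_eq X]
    funext i
    exact hx

/-! ### One sheet: the rule-2 move along the x-map -/

/-- **One sheet, one move of rule (2).** Let `r` be a representation whose domain `σ` lies in
`{x³ − x > 0}` and inside one half-line (`p 0 · q 0 > 0` on `σ`), with integrand `1/√(x³ − x)` on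
`σ`, and let `s` be a representation with domain `Φ σ`, `Φ(x) = x − 1/x`, and integrand
`1/√(X³ + 4X)` there. Then `[r] − [s] ∈ KZ.changeOfVariablesRel`, witnessed by
`(Φ, Φ' = (1 + 1/x²)·id)`: `Φ` is `ℚ`-semialgebraic and injective on `σ`, `det Φ' = 1 + 1/x²`, and the
Jacobian identity is `jacobian_identity`. [cite: KontsevichZagier2001, §1.2 rule (2)] -/
theorem sheet_cov (r s : KZ.IntegralRep 1)
    (hP : ∀ p ∈ r.domain, 0 < p 0 ^ 3 - p 0)
    (hsame : ∀ p ∈ r.domain, ∀ q ∈ r.domain, 0 < p 0 * q 0)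
    (hr : EqOn r.integrand (fun x => 1 / Real.sqrt (x 0 ^ 3 - x 0)) r.domain)
    (hsd : s.domain = (fun (p : Fin 1 → ℝ) (_ : Fin 1) => p 0 - (p 0)⁻¹) '' r.domain)
    (hsi : ∀ X ∈ s.domain, s.integrand X = 1 / Real.sqrt (X 0 ^ 3 + 4 * X 0)) :
    KZ.of r - KZ.of s ∈ KZ.changeOfVariablesRel := by
  set Φ : (Fin 1 → ℝ) → (Fin 1 → ℝ) := fun p _ => p 0 - (p 0)⁻¹ with hΦ_def
  set Φ' : (Fin 1 → ℝ) → ((Fin 1 → ℝ) →L[ℝ] (Fin 1 → ℝ)) :=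
    fun p => (1 + ((p 0) ^ 2)⁻¹) • ContinuousLinearMap.id ℝ (Fin 1 → ℝ) with hΦ'_def
  have h0 : ∀ p ∈ r.domain, p 0 ≠ 0 := fun p hp h => by
    have := hP p hp
    rw [h] at this
    norm_num at this
  -- Φ is a semialgebraic map, injective on σ, with derivative Φ' within σ
  have hΦsa : IsSemialgebraicMapOn ℚ r.domain Φ := isSemialgebraicMapOn_xMap r.isSemialgebraic_domain h0
  have hderiv : ∀ p ∈ r.domain, HasFDerivWithinAt Φ (Φ' p) r.domain p := fun p hp =>
    (hasFDerivAt_fin_one (fun y : ℝ => y - y⁻¹) (1 + ((p 0) ^ 2)⁻¹) p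
      (hasDerivAt_sub_inv (h0 p hp))).hasFDerivWithinAt
  have hinj : InjOn Φ r.domain := by
    intro p hp q hq h
    have h' : p 0 - (p 0)⁻¹ = q 0 - (q 0)⁻¹ := congrFun h 0
    have hpq : p 0 = q 0 := sub_inv_injective (hsame p hp q hq) h'
    rw [← const_apply_zero_eq p, ← const_apply_zero_eq q, hpq]
  have hdet : ∀ p, (Φ' p).det = 1 + ((p 0) ^ 2)⁻¹ := fun p => det_smul_id_fin_one _
  -- the Jacobian identity on σ
  have hjac : ∀ p ∈ r.domain, r.integrand p = s.integrand (Φ p) * |(Φ' p).det| := by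
    intro p hp
    have hmem : Φ p ∈ s.domain := hsd ▸ mem_image_of_mem Φ hp
    rw [hr hp, hsi _ hmem, hdet p]
    exact jacobian_identity (hP p hp)
  exact ⟨1, r, s, Φ, Φ', hΦsa, hderiv, hinj, hsd, hjac, rfl⟩

/-! ### The crux: four moves -/

/-- **`LemniscateTwoIsogeny`** (stmt-KontsevichZagierPeriods-5382): for any integral representations
`r = [{x³ − x > 0}, 1/√(x³ − x)]` and `r' = [{X³ + 4X > 0}, 2/√(X³ + 4X)]` (integrands prescribed on
the domains only), `KZ.Equivalent r r'`. Derivation in four moves: domain additivity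
`[r] = [r|(−1,0)] + [r|(1,∞)]` (rule 1a); two changes of variables along the x-map `X = x − 1/x` of
the 2-isogeny `y² = x³ − x → Y² = X³ + 4X`, each sheet onto `s = [{X³ + 4X > 0}, 1/√(X³ + 4X)]`
(rule 2, `sheet_cov`); integrand additivity `[r'] = [s] + [s]` (rule 1b).
[cite: SilvermanAEC2009, Example III.4.5] -/
theorem LemniscateTwoIsogeny_proof :
    Summit.KontsevichZagierPeriods.KontsevichZagierPeriods.Theses.IsogenyCertificates.LemniscateTwoIsogeny := by
  unfold Summit.KontsevichZagierPeriods.KontsevichZagierPeriods.Theses.IsogenyCertificates.LemniscateTwoIsogeny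
  intro r r' h1 h2 h3 h4
  -- the two sheets of `{x³ − x > 0}`
  have hsub₁ : {p : Fin 1 → ℝ | -1 < p 0 ∧ p 0 < 0} ⊆ r.domain := fun p hp => by
    rw [h1]; exact (cube_sub_self_pos_iff (p 0)).mpr (Or.inl hp)
  have hsub₂ : {p : Fin 1 → ℝ | 1 < p 0} ⊆ r.domain := fun p hp => by
    rw [h1]; exact (cube_sub_self_pos_iff (p 0)).mpr (Or.inr hp)
  set r₁ : KZ.IntegralRep 1 := r.restrict _ isSemialgebraic_egg hsub₁ with hr₁
  set r₂ : KZ.IntegralRep 1 := r.restrict _ isSemialgebraic_Ioi_one hsub₂ with hr₂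
  -- the common target `s = [r'.domain, 1/√(X³ + 4X)]`
  have hmeas' : MeasurableSet r'.domain := KZ.IntegralRep.measurableSet_domain_holds r'
  have hs_sa : IsSemialgebraicFunOn ℚ r'.domain (fun X => 1 / Real.sqrt (X 0 ^ 3 + 4 * X 0)) :=
    ((isSemialgebraicFunOn_const_ratCast r'.isSemialgebraic_domain (1 / 2 : ℚ)).fun_mul
      (r'.isSemialgebraicFunOn_integrand.congr h4)).congr fun X _ => by
        push_cast
        ring
  have hs_int : IntegrableOn (fun X => 1 / Real.sqrt (X 0 ^ 3 + 4 * X 0)) r'.domain := by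
    have h5 : IntegrableOn (fun X : Fin 1 → ℝ => (1 / 2 : ℝ) * (2 / Real.sqrt (X 0 ^ 3 + 4 * X 0)))
        r'.domain := (r'.integrableOn.congr_fun h4 hmeas').const_mul (1 / 2 : ℝ)
    exact h5.congr_fun (fun X _ => by ring) hmeas'
  set s : KZ.IntegralRep 1 :=
    { domain := r'.domain, integrand := fun X => 1 / Real.sqrt (X 0 ^ 3 + 4 * X 0),
      isSemialgebraic_domain := r'.isSemialgebraic_domain,
      isSemialgebraicFunOn_integrand := hs_sa, integrableOn := hs_int } with hs
  -- move 1: domain additivity `[r] − [r₁] − [r₂]`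
  have hA : KZ.of r - KZ.of r₁ - KZ.of r₂ ∈ KZ.relations := by
    refine KZ.domainAddRel_subset_relations ⟨1, r, r₁, r₂, ?_, ?_, fun _ _ => rfl, fun _ _ => rfl, rfl⟩
    · rw [KZ.IntegralRep.domain_restrict, KZ.IntegralRep.domain_restrict, h1]
      ext p
      simp only [mem_setOf_eq, mem_union]
      rw [cube_sub_self_pos_iff]
      simp only [mem_union, mem_Ioo, mem_Ioi]
    · have he : r₁.domain ∩ r₂.domain = ∅ := by
        rw [KZ.IntegralRep.domain_restrict, KZ.IntegralRep.domain_restrict]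
        ext p
        simp only [mem_inter_iff, mem_setOf_eq, mem_empty_iff_false, iff_false, not_and]
        intro h h'
        linarith [h.2]
      rw [he, measure_empty]
  -- moves 2, 3: change of variables on each sheet onto `s`
  have hC₁ : KZ.of r₁ - KZ.of s ∈ KZ.relations := by
    refine KZ.changeOfVariablesRel_subset_relations (sheet_cov r₁ s ?_ ?_ ?_ ?_ ?_)
    · intro p hp; exact (cube_sub_self_pos_iff (p 0)).mpr (Or.inl hp)
    · intro p hp q hq; exact mul_pos_of_neg_of_neg hp.2 hq.2
    · intro p hp; exact h2 (hsub₁ hp)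
    · rw [KZ.IntegralRep.domain_restrict, image_xMap_egg]; exact h3
    · intro X _; rfl
  have hC₂ : KZ.of r₂ - KZ.of s ∈ KZ.relations := by
    refine KZ.changeOfVariablesRel_subset_relations (sheet_cov r₂ s ?_ ?_ ?_ ?_ ?_)
    · intro p hp; exact (cube_sub_self_pos_iff (p 0)).mpr (Or.inr hp)
    · intro p hp q hq
      have hp' : 1 < p 0 := hp
      have hq' : 1 < q 0 := hq
      exact mul_pos (by linarith) (by linarith)
    · intro p hp; exact h2 (hsub₂ hp)
    · rw [KZ.IntegralRep.domain_restrict, image_xMap_unbounded]; exact h3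
    · intro X _; rfl
  -- move 4: integrand additivity `[r'] − [s] − [s]`
  have hB : KZ.of r' - KZ.of s - KZ.of s ∈ KZ.relations := by
    refine KZ.integrandAddRel_subset_relations ⟨1, r', s, s, rfl, rfl, fun X hX => ?_, rfl⟩
    rw [Pi.add_apply, h4 hX]
    show 2 / Real.sqrt (X 0 ^ 3 + 4 * X 0) =
      1 / Real.sqrt (X 0 ^ 3 + 4 * X 0) + 1 / Real.sqrt (X 0 ^ 3 + 4 * X 0)
    ring
  -- compose
  have h := KZ.relations.sub_mem (KZ.relations.add_mem (KZ.relations.add_mem hA hC₁) hC₂) hB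
  show KZ.of r - KZ.of r' ∈ KZ.relations
  convert h using 1
  abel

end Summit.KontsevichZagierPeriods.IsogenyCertificates.LemniscateTwoIsogeny

end
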